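import Mathlib
import Literature.NumberTheory.Transcendental.KZCalculus
import Literature.NumberTheory.Transcendental.KZLogCalculusProofs
import Summits.KontsevichZagierPeriods.KontsevichZagierPeriods.Theorems.TorsionLogsNeronTorsionSectorStubHaarReps
import Summits.KontsevichZagierPeriods.KontsevichZagierPeriods.Theorems.TorsionLogsNeronTorsionSectorStubCellStepInst
import Summits.KontsevichZagierPeriods.KontsevichZagierPeriods.Theorems.TorsionLogsNeronTorsionSectorStubUpStepInst
import Summits.KontsevichZagierPeriods.KontsevichZagierPeriods.Theorems.TorsionLogsNeronTorsionSectorStubDlogUnfoldAux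
import Summits.KontsevichZagierPeriods.KontsevichZagierPeriods.Theorems.TorsionLogsNeronTorsionSectorAssemblyRows
import Summits.KontsevichZagierPeriods.KontsevichZagierPeriods.Theorems.TorsionLogsNeronTorsionSectorAssemblyDecomp
import Summits.KontsevichZagierPeriods.KontsevichZagierPeriods.Theorems.TorsionLogsNeronTorsionSectorStubCornerChartLower
import HarnessLib

/-!
# Crux `TorsionLogs.NeronTorsionSector` (stmt-KontsevichZagierPeriods-14500) — assembly, x-chart slice: the regular steps

Helper for the lead's stub `stub_assembly` (line `registered`): on the interface representations (diagonal
half-cells `t_j`, column-1 cells `c_j`, third-kind reps `θ_j`, constants `ℓ(v)`, specified by domain and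
integrand), the relations of the regular part of the translation chain: the up-steps
`t_{j+1} − t_j − ℓ(q_{j+1}) + θ_j ∈ relations` (`stub_upStepInst` + integrand split + row shifts of the constants by
Haar invariance), the cell recursion `c_{j+1} − c_j − ℓ(q_{j+1}) + ℓ(q_j) ∈ relations` (`stub_cellStepInst`), the
additivity of `ℓ`, and the algebraicity of the cocycle values `q_j = Qf(x j)`. [cite: KontsevichZagier2001, §1.2]
-/

noncomputable section

open Set MeasureTheory Filter Topology
open Literature.NumberTheory.Transcendental Literature.NumberTheory.Transcendental.KZ
open Literature.ModelTheory.ExponentialFields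
open Summit.KontsevichZagierPeriods.HyperbolicBloch.OffTetraSectorKernel (isSemialgebraic_logIvl exists_logRep)

-- `Summit.KontsevichZagierPeriods.KontsevichZagierPeriods.…` is the tree's mandated layout (single-conjunct summit).
set_option linter.dupNamespace false

namespace Summit.KontsevichZagierPeriods.KontsevichZagierPeriods.Cruxes.NeronTorsionSector.Translation

/-- **x-chart slice, regular steps** (see the module docstring). [cite: KontsevichZagier2001, §1.2] -/
theorem asmX_steps :
    ∀ (g₂ g₃ e₁ L₁ : ℝ) (m : ℕ) (x y : ℕ → ℝ) (f yb sl τ Y3 Qf sl3 X33 Y33 Qf3 Pg G τ' : ℝ → ℝ),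
    (∀ t, f t = 4 * t ^ 3 - g₂ * t - g₃) → f e₁ = 0 → 0 < e₁ → (∀ t, e₁ < t → 0 < f t) →
    6 ≤ m → x m = e₁ →
    (∀ k, 1 ≤ k → k < m → e₁ < x k ∧ y k < 0) → (∀ k, 1 ≤ k → k < m → x (k + 1) < x k) →
    (∀ k, 1 ≤ k → k ≤ m → IsAlgebraic ℚ (x k)) →
    (∀ k, 1 ≤ k → k < m → IsAlgebraic ℚ (y k) ∧ y k ^ 2 = f (x k)) →
    IsAlgebraic ℚ g₂ → IsAlgebraic ℚ g₃ →
    L₁ = (12 * x 1 ^ 2 - g₂) / (2 * y 1) → x 2 = L₁ ^ 2 / 4 - 2 * x 1 → y 2 = -(y 1 + L₁ * (x 2 - x 1)) →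
    yb = (fun t => -Real.sqrt (f t)) →
    sl = (fun t => (4 * t ^ 2 + 4 * t * x 1 + 4 * x 1 ^ 2 - g₂) / (yb t + y 1)) →
    τ = (fun t => sl t ^ 2 / 4 - t - x 1) →
    Y3 = (fun t => -(yb t + sl t * (τ t - t))) →
    Qf = (fun t => sl t / 2 + Y3 t / (2 * τ t) - yb t / (2 * t)) →
    sl3 = (fun t => (4 * τ t ^ 2 + 4 * τ t * x 1 + 4 * x 1 ^ 2 - g₂) / (Y3 t + y 1)) →
    X33 = (fun t => sl3 t ^ 2 / 4 - τ t - x 1) →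
    Y33 = (fun t => -(Y3 t + sl3 t * (X33 t - τ t))) →
    Qf3 = (fun t => sl3 t / 2 + Y33 t / (2 * X33 t) - Y3 t / (2 * τ t)) →
    Pg = (fun t => 4 * (t + 2 * x 1) * y 1 - L₁ * (4 * t ^ 2 + 4 * t * x 1 + 4 * x 1 ^ 2 - g₂)
      + 4 * (t + 2 * x 1) * yb t) →
    G = (fun t => Pg t / (yb t + y 1) ^ 2 * Real.sqrt (t * X33 t) / τ t) →
    τ' = (fun t => Y3 t / yb t) →
    MeasureTheory.IntegrableOn (fun t => (Real.sqrt (f t))⁻¹) (Set.Ioi e₁) →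
    StrictMonoOn τ (Set.Ici (x 1)) → τ '' Set.Ioi (x 1) = Set.Ioo (x 2) (x 1) →
    (∀ k, 1 ≤ k → k + 2 ≤ m → StrictMonoOn τ (Set.Icc (x (k + 1)) (x k)) ∧
      τ '' Set.Ioo (x (k + 1)) (x k) = Set.Ioo (x (k + 2)) (x (k + 1)) ∧
      τ (x k) = x (k + 1) ∧ τ (x (k + 1)) = x (k + 2)) →
    StrictAntiOn τ (Set.Icc e₁ (x (m - 1))) → τ '' Set.Ioo e₁ (x (m - 1)) = Set.Ioo e₁ (x (m - 1)) →
    τ e₁ = x (m - 1) → τ (x (m - 1)) = e₁ →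
    ∀ (Tx C1 : ℕ → Literature.NumberTheory.Transcendental.KZ.IntegralRep 2)
      (Θx : ℕ → Literature.NumberTheory.Transcendental.KZ.IntegralRep 1)
      (L1 : ℝ → Literature.NumberTheory.Transcendental.KZ.IntegralRep 1),
    (∀ j, 1 ≤ j → j < m → (Tx j).domain = {z | x (j + 1) < z 1 ∧ z 1 < z 0 ∧ z 0 < x j} ∧
      Set.EqOn (Tx j).integrand (fun z => (g₂ * z 1 + 2 * g₃) / (4 * (z 1) ^ 2) / (Real.sqrt (f (z 0)) * Real.sqrt (f (z 1)))) (Tx j).domain) →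
    (∀ j, 1 ≤ j → j < m → (C1 j).domain = {z | (x 2 < z 0 ∧ z 0 < x 1) ∧ x (j + 1) < z 1 ∧ z 1 < x j} ∧
      Set.EqOn (C1 j).integrand (fun z => (g₂ * z 1 + 2 * g₃) / (4 * (z 1) ^ 2) / (Real.sqrt (f (z 0)) * Real.sqrt (f (z 1)))) (C1 j).domain) →
    (∀ j, 1 ≤ j → j < m → (Θx j).domain = {t | x (j + 1) < t 0 ∧ t 0 < x j} ∧
      Set.EqOn (Θx j).integrand (fun t => Qf (t 0) / Real.sqrt (f (t 0))) (Θx j).domain) →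
    (∀ v, IsAlgebraic ℚ v → (L1 v).domain = {t | x 2 < t 0 ∧ t 0 < x 1} ∧
      Set.EqOn (L1 v).integrand (fun t => v / Real.sqrt (f (t 0))) (L1 v).domain) →
    (∀ j, 1 ≤ j → j + 1 < m → Literature.NumberTheory.Transcendental.KZ.of (Tx (j + 1)) -
      Literature.NumberTheory.Transcendental.KZ.of (Tx j) - Literature.NumberTheory.Transcendental.KZ.of (L1 (Qf (x (j + 1))))
      + Literature.NumberTheory.Transcendental.KZ.of (Θx j) ∈ Literature.NumberTheory.Transcendental.KZ.relations) ∧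
    (∀ j, 1 ≤ j → j + 1 < m → Literature.NumberTheory.Transcendental.KZ.of (C1 (j + 1)) -
      Literature.NumberTheory.Transcendental.KZ.of (C1 j) - Literature.NumberTheory.Transcendental.KZ.of (L1 (Qf (x (j + 1))))
      + Literature.NumberTheory.Transcendental.KZ.of (L1 (Qf (x j))) ∈ Literature.NumberTheory.Transcendental.KZ.relations) ∧
    (∀ a b : ℝ, IsAlgebraic ℚ a → IsAlgebraic ℚ b → Literature.NumberTheory.Transcendental.KZ.of (L1 (a + b)) -
      Literature.NumberTheory.Transcendental.KZ.of (L1 a) - Literature.NumberTheory.Transcendental.KZ.of (L1 b) ∈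
      Literature.NumberTheory.Transcendental.KZ.relations) ∧
    (∀ j, 1 ≤ j → j < m → IsAlgebraic ℚ (Qf (x j))) := by
  intro g₂ g₃ e₁ L₁ m x y f yb sl τ Y3 Qf sl3 X33 Y33 Qf3 Pg G τ' hf he₁ he₁pos hfpos hm6 hxm hgLow hgDec hgAlg'
    hgAlgy ag₂ ag₃ hL₁ hx2 hy2 hyb hsl hτ hY3 hQf hsl3 hX33 hY33 hQf3 hPg hG hτ' hInt hτmono0 hτimg0 hτcell hτfanti hτfimg
    hτe₁ hτm1 Tx C1 Θx L1 hTx hC1 hΘx hL1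
  have hx1 : e₁ < x 1 ∧ y 1 < 0 := hgLow 1 le_rfl (lt_of_lt_of_le (by norm_num) hm6)
  have h1m : 1 < m := lt_of_lt_of_le (by norm_num) hm6
  have h2m : 2 < m := lt_of_lt_of_le (by norm_num) hm6
  have h3m : 3 < m := lt_of_lt_of_le (by norm_num) hm6
  have hmm : m ≤ m := le_rfl
  have hm1 : m - 1 + 1 = m := Nat.sub_add_cancel h1m.le
  have hm1lt : m - 1 < m := Nat.sub_lt (Nat.zero_lt_of_lt h1m) Nat.one_pos
  have h1m1 : 1 ≤ m - 1 := Nat.le_sub_one_of_lt h1m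
  have hx1pos : 0 < x 1 := he₁pos.trans hx1.1
  have hx1alg : IsAlgebraic ℚ (x 1) := hgAlg' 1 le_rfl h1m.le
  have hy1 : IsAlgebraic ℚ (y 1) ∧ y 1 ^ 2 = f (x 1) := hgAlgy 1 le_rfl h1m
  have hx2low : e₁ < x 2 ∧ y 2 < 0 := hgLow 2 (by norm_num) h2m
  have hx2pos : 0 < x 2 := he₁pos.trans hx2low.1
  have hx2alg : IsAlgebraic ℚ (x 2) := hgAlg' 2 (by norm_num) h2m.le
  have hx21 : x 2 < x 1 := hgDec 1 le_rfl h1m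
  have he₁a : IsAlgebraic ℚ e₁ := by rw [← hxm]; exact hgAlg' m h1m.le hmm
  have hanti := asmDecomp_anti x m hgDec
  have hsanti := asmDecomp_strictAnti x m hgDec
  obtain ⟨-, -, -, hyby, hsemi, hrows, hfold⟩ := asmRows_package g₂ g₃ e₁ L₁ m x y f yb sl τ Y3 Qf sl3 X33 Y33 Qf3 Pg G
    τ' hf he₁ he₁pos hfpos hm6 hxm hgLow hgDec hgAlg' hy1.2 hy1.1 ag₂ ag₃ hL₁ hx2 hy2 hyb hsl hτ hY3 hQf hsl3 hX33 hY33 hQf3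
    hPg hG hτ' hτmono0 hτimg0 hτcell hτfanti hτfimg hτe₁ hτm1
  -- algebraicity of the cocycle values on the grid
  have hdiv : ∀ {a b : ℝ}, IsAlgebraic ℚ a → IsAlgebraic ℚ b → IsAlgebraic ℚ (a / b) := fun ha hb => by
    rw [div_eq_mul_inv]; exact ha.mul (IsAlgebraic.inv_iff.mpr hb)
  have hnat : ∀ k : ℕ, IsAlgebraic ℚ (k : ℝ) := fun k => by simpa using isAlgebraic_algebraMap (R := ℚ) (A := ℝ) (k : ℚ)
  have hQfalg : ∀ k, 1 ≤ k → k < m → IsAlgebraic ℚ (Qf (x k)) := by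
    intro k hk hkm
    obtain ⟨hyk, hyk2⟩ := hgAlgy k hk hkm
    have hxk := hgAlg' k hk hkm.le
    have hybk : yb (x k) = y k := by
      simp only [hyb]; rw [← hyk2, Real.sqrt_sq_eq_abs, abs_of_neg (hgLow k hk hkm).2, neg_neg]
    have hybk' : IsAlgebraic ℚ (yb (x k)) := by rw [hybk]; exact hyk
    have h4 : IsAlgebraic ℚ (4 : ℝ) := by simpa using hnat 4
    have h2 : IsAlgebraic ℚ (2 : ℝ) := by simpa using hnat 2
    have hslk : IsAlgebraic ℚ (sl (x k)) := by
      simp only [hsl]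
      exact hdiv ((((h4.mul (hxk.pow 2)).add ((h4.mul hxk).mul hx1alg)).add (h4.mul (hx1alg.pow 2))).sub ag₂)
        (hybk'.add hy1.1)
    have hτk : IsAlgebraic ℚ (τ (x k)) := by
      simp only [hτ]; exact ((hdiv (hslk.pow 2) h4).sub hxk).sub hx1alg
    have hY3k : IsAlgebraic ℚ (Y3 (x k)) := by
      simp only [hY3]; exact (hybk'.add (hslk.mul (hτk.sub hxk))).neg
    simp only [hQf]
    exact ((hdiv hslk h2).add (hdiv hY3k (h2.mul hτk))).sub (hdiv hybk' (h2.mul hxk))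
  -- kernel bound and interval tools
  set Cb : ℝ := |g₂| / (4 * e₁) + |g₃| / (2 * e₁ ^ 2) with hCb
  have hCbd : ∀ t, e₁ < t → |(g₂ * t + 2 * g₃) / (4 * t ^ 2)| ≤ Cb := by
    intro t ht
    have ht0 : 0 < t := he₁pos.trans ht
    rw [abs_div, abs_of_pos (by positivity : (0:ℝ) < 4 * t ^ 2), hCb]
    calc |g₂ * t + 2 * g₃| / (4 * t ^ 2) ≤ (|g₂| * t + 2 * |g₃|) / (4 * t ^ 2) := by
            gcongr
            calc |g₂ * t + 2 * g₃| ≤ |g₂ * t| + |2 * g₃| := abs_add_le _ _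
              _ = |g₂| * t + 2 * |g₃| := by rw [abs_mul, abs_mul, abs_of_pos ht0, abs_two]
      _ = |g₂| / (4 * t) + |g₃| / (2 * t ^ 2) := by field_simp; ring
      _ ≤ |g₂| / (4 * e₁) + |g₃| / (2 * e₁ ^ 2) := by gcongr
  have hxk_gt : ∀ k, 1 ≤ k → k ≤ m → ∀ t, x k < t → e₁ < t := fun k hk hkm t ht =>
    lt_of_le_of_lt (hxm.symm.le.trans (hanti k m hk hkm hmm)) ht
  have hrowσ : ∀ j, 1 ≤ j → j < m → IsSemialgebraic ℚ {p : Fin 1 → ℝ | p 0 ∈ Set.Ioo (x (j + 1)) (x j)} :=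
    fun j hj hjm => isSemialgebraic_logIvl (hgAlg' (j + 1) (Nat.le_add_left 1 j) hjm) (hgAlg' j hj hjm.le)
  have hIccσ : ∀ j, 1 ≤ j → j < m → IsSemialgebraic ℚ {p : Fin 1 → ℝ | p 0 ∈ Set.Icc (x (j + 1)) (x j)} :=
    fun j hj hjm => cornerLower_isSemialgebraic_slab (hgAlg' (j + 1) (Nat.le_add_left 1 j) hjm) (hgAlg' j hj hjm.le)
  have hrow_sub : ∀ j, 1 ≤ j → j < m → Set.Ioo (x (j + 1)) (x j) ⊆ Set.Ioi e₁ :=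
    fun j hj hjm t ht => hxk_gt (j + 1) (Nat.le_add_left 1 j) hjm t ht.1
  have h1D := stub_haarReps.1
  have hrowRep : ∀ j, 1 ≤ j → j < m → ∀ g : ℝ → ℝ, ContinuousOn g (Set.Icc (x (j + 1)) (x j)) →
      IsSemialgebraicFunOn ℚ {p : Fin 1 → ℝ | p 0 ∈ Set.Ioo (x (j + 1)) (x j)} (fun p => g (p 0)) →
      ∃ r : IntegralRep 1, r.domain = {t | x (j + 1) < t 0 ∧ t 0 < x j} ∧
        r.integrand = fun t => g (t 0) / Real.sqrt (f (t 0)) := by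
    intro j hj hjm g hgc hgσ
    obtain ⟨M, hM⟩ := (isCompact_Icc.image_of_continuousOn hgc).isBounded.subset_closedBall_lt 0 0
    obtain ⟨r, hd, hi⟩ := h1D g₂ g₃ e₁ M f g (Set.Ioo (x (j + 1)) (x j)) ag₂ ag₃ he₁a hf hfpos hInt (hrow_sub j hj hjm)
      (hrowσ j hj hjm) hgσ (hgc.mono Ioo_subset_Icc_self) fun t ht => by
        have := hM.2 ⟨t, Ioo_subset_Icc_self ht, rfl⟩
        rw [Metric.mem_closedBall, dist_zero_right, Real.norm_eq_abs] at this
        exact this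
    exact ⟨r, hd, hi⟩
  have hQfcj : ∀ j, 1 ≤ j → j + 2 ≤ m → ContinuousOn Qf (Set.Icc (x (j + 1)) (x j)) := fun j hj hjm => (hrows j hj hjm).2.2.1
  have hsemiQf : ∀ j, 1 ≤ j → j < m →
      IsSemialgebraicFunOn ℚ {p : Fin 1 → ℝ | p 0 ∈ Set.Ioo (x (j + 1)) (x j)} (fun p => Qf (p 0)) :=
    fun j hj hjm => (hsemi _ (hrowσ j hj hjm)).2.1
  -- auxiliary reps: `rOup j = [row j, (Qf (x (j+1)) − Qf)/√f]`, `Lrow j v = [row j, v/√f]`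
  have hrOup : ∀ j, ∃ r : IntegralRep 1, 1 ≤ j → j + 2 ≤ m →
      r.domain = {t | x (j + 1) < t 0 ∧ t 0 < x j} ∧
        r.integrand = fun t => (Qf (x (j + 1)) - Qf (t 0)) / Real.sqrt (f (t 0)) := by
    intro j
    by_cases h : 1 ≤ j ∧ j + 2 ≤ m
    · have hj1m : j + 1 < m := h.2
      obtain ⟨r, hd, hi⟩ := hrowRep j h.1 (Nat.lt_of_succ_lt hj1m) (fun t => Qf (x (j + 1)) - Qf t)
        (continuousOn_const.sub (hQfcj j h.1 h.2))
        (IsSemialgebraicFunOn.sub_holds (isSemialgebraicFunOn_const_of_isAlgebraic (hrowσ j h.1 (Nat.lt_of_succ_lt hj1m))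
          (hQfalg (j + 1) (Nat.le_add_left 1 j) hj1m)) (hsemiQf j h.1 (Nat.lt_of_succ_lt hj1m)))
      exact ⟨r, fun _ _ => ⟨hd, hi⟩⟩
    · exact ⟨Θx 1, fun h1 h2 => absurd ⟨h1, h2⟩ h⟩
  choose rOup hrOup using hrOup
  have hLrow : ∀ j v, ∃ r : IntegralRep 1, 1 ≤ j → j < m → IsAlgebraic ℚ v →
      r.domain = {t | x (j + 1) < t 0 ∧ t 0 < x j} ∧ r.integrand = fun t => v / Real.sqrt (f (t 0)) := by
    intro j v
    by_cases h : 1 ≤ j ∧ j < m ∧ IsAlgebraic ℚ v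
    · obtain ⟨r, hd, hi⟩ := hrowRep j h.1 h.2.1 (fun _ => v) continuousOn_const
        (isSemialgebraicFunOn_const_of_isAlgebraic (hrowσ j h.1 h.2.1) h.2.2)
      exact ⟨r, fun _ _ _ => ⟨hd, hi⟩⟩
    · exact ⟨Θx 1, fun h1 h2 h3 => absurd ⟨h1, h2, h3⟩ h⟩
  choose Lrow hLrow using hLrow
  have hsplit1 : ∀ (r r₁ r₂ : IntegralRep 1), r₁.domain = r.domain → r₂.domain = r.domain →
      Set.EqOn r.integrand (r₁.integrand + r₂.integrand) r.domain → of r - of r₁ - of r₂ ∈ relations :=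
    fun r r₁ r₂ h1 h2 h3 => KZ.integrandAddRel_subset_relations ⟨1, r, r₁, r₂, h1, h2, h3, rfl⟩
  -- `Lrow 1 v ≡ L1 v`
  have hLrow1 : ∀ v, IsAlgebraic ℚ v → of (Lrow 1 v) - of (L1 v) ∈ relations := by
    intro v hv
    obtain ⟨hd, hi⟩ := hLrow 1 v le_rfl h1m hv
    obtain ⟨hd', hi'⟩ := hL1 v hv
    refine KZ.of_sub_of_mem_relations_of_eqOn (by rw [hd', hd]) fun t ht => ?_
    rw [hi, hi' (by rw [hd', ← hd]; exact ht)]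
  -- integrand split of `rOup`
  have hrOup_split : ∀ j (hj : 1 ≤ j) (hjm : j + 2 ≤ m),
      of (Lrow j (Qf (x (j + 1)))) - of (rOup j) - of (Θx j) ∈ relations := by
    intro j hj hjm
    have hj1m : j + 1 < m := hjm
    obtain ⟨hLd, hLi⟩ := hLrow j _ hj (Nat.lt_of_succ_lt hj1m) (hQfalg (j + 1) (Nat.le_add_left 1 j) hj1m)
    obtain ⟨hOd, hOi⟩ := hrOup j hj hjm
    obtain ⟨hΘd, hΘi⟩ := hΘx j hj (Nat.lt_of_succ_lt hj1m)
    refine hsplit1 _ _ _ (by rw [hOd, hLd]) (by rw [hΘd, hLd]) fun t ht => ?_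
    rw [Pi.add_apply, hLi, hOi, hΘi (by rw [hΘd, ← hLd]; exact ht)]; ring
  -- row shifts of the constants (Haar invariance of `τ`)
  have hLrow_shift : ∀ j v, 1 ≤ j → j + 2 ≤ m → IsAlgebraic ℚ v →
      of (Lrow j v) - of (Lrow (j + 1) v) ∈ relations := by
    intro j v hj hjm hv
    have hj1m : j + 1 < m := hjm
    obtain ⟨hd, hi⟩ := hLrow j v hj (Nat.lt_of_succ_lt hj1m) hv
    obtain ⟨hd', hi'⟩ := hLrow (j + 1) v (Nat.le_add_left 1 j) hj1m hv
    obtain ⟨hrange, hstep, -⟩ := hrows j hj hjm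
    obtain ⟨hmono, himg, -, -⟩ := hτcell j hj hjm
    refine of_sub_of_mem_relations_of_cov_fin_one (G := τ) (G' := τ') (I := Set.Ioo (x (j + 1)) (x j)) _ _
      (by rw [hd]; rfl) (by rw [hd]; exact (hsemi _ (hrowσ j hj (Nat.lt_of_succ_lt hj1m))).1) (fun t ht => (hstep t ht).1)
      (hmono.injOn.mono Ioo_subset_Icc_self) (by rw [hd', himg]; rfl) fun t ht => ?_
    rw [hd] at ht
    obtain ⟨_, hhaar⟩ := hstep (t 0) ht
    have hfτ : 0 < Real.sqrt (f (τ (t 0))) := by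
      have : τ (t 0) ∈ Set.Ioo (x (j + 2)) (x (j + 1)) := by rw [← himg]; exact ⟨t 0, ht, rfl⟩
      exact Real.sqrt_pos.2 (hfpos _ (hxk_gt (j + 2) (Nat.le_add_left 1 (j + 1)) hjm _ this.1))
    have hτ'0 : |τ' (t 0)| ≠ 0 := by
      intro h; rw [h, zero_mul] at hhaar; exact hfτ.ne' hhaar.symm
    rw [hi, hi']
    show v / Real.sqrt (f (t 0)) = v / Real.sqrt (f (τ (t 0))) * |τ' (t 0)|
    rw [← hhaar, div_mul_eq_mul_div, mul_comm v, mul_div_mul_left _ _ hτ'0]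
  have hLrow_toL1 : ∀ j v, 1 ≤ j → j < m → IsAlgebraic ℚ v → of (Lrow j v) - of (L1 v) ∈ relations := by
    intro j v hj hjm hv
    induction j, hj using Nat.le_induction with
    | base => exact hLrow1 v hv
    | succ k hk ih =>
      have h1 := hLrow_shift k v hk hjm hv
      have h2 := ih (Nat.lt_of_succ_lt hjm)
      rw [← sub_sub_sub_cancel_left (of (L1 v)) (of (Lrow (k + 1) v)) (of (Lrow k v))]
      exact relations.sub_mem h2 h1
  refine ⟨?_, ?_, ?_, hQfalg⟩
  · -- the up-steps
    intro j hj hj1m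
    have hjm : j + 2 ≤ m := hj1m
    have hjm' : j < m := Nat.lt_of_succ_lt hj1m
    have h1j1 : 1 ≤ j + 1 := Nat.le_add_left 1 j
    have h1j2 : 1 ≤ j + 2 := Nat.le_add_left 1 (j + 1)
    have halg : IsAlgebraic ℚ (Qf (x (j + 1))) := hQfalg (j + 1) h1j1 hj1m
    obtain ⟨hmono, himg, -, -⟩ := hτcell j hj hjm
    obtain ⟨-, hstep, hQfc', hQfd', -⟩ := hrows j hj hjm
    obtain ⟨hOd, hOi⟩ := hrOup j hj hjm
    have A : of (Tx (j + 1)) - of (Tx j) - of (rOup j) ∈ relations :=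
      stub_upStepInst g₂ g₃ e₁ (x (j + 1)) (x j) (x (j + 2)) (x (j + 1)) Cb f τ τ' Qf (Tx j) (Tx (j + 1))
        (rOup j) hf ag₂ ag₃ (hgAlg' (j + 1) h1j1 hj1m.le) (hgAlg' j hj hjm'.le) (hgAlg' (j + 2) h1j2 hjm)
        (hgAlg' (j + 1) h1j1 hj1m.le) he₁pos (hgLow (j + 1) h1j1 hj1m).1 (hgDec j hj hjm')
        (hxm.symm.le.trans (hanti (j + 2) m h1j2 hjm hmm)) (hgDec (j + 1) h1j1 hj1m) hfpos hCbd
        (hInt.mono_set (hrow_sub j hj hjm')) hmono himg hstep (hsemi _ (hrowσ j hj hjm')).1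
        (hsemi _ (hIccσ j hj hjm')).2.1 hQfc' hQfd' (hTx j hj hjm').1 (hTx j hj hjm').2 (hTx (j + 1) h1j1 hj1m).1
        (hTx (j + 1) h1j1 hj1m).2 hOd (fun t _ => by rw [hOi])
    rw [show of (Tx (j + 1)) - of (Tx j) - of (L1 (Qf (x (j + 1)))) + of (Θx j) =
      (of (Tx (j + 1)) - of (Tx j) - of (rOup j)) - (of (Lrow j (Qf (x (j + 1)))) - of (rOup j) - of (Θx j))
      + (of (Lrow j (Qf (x (j + 1)))) - of (L1 (Qf (x (j + 1))))) by abel]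
    exact relations.add_mem (relations.sub_mem A (hrOup_split j hj hjm)) (hLrow_toL1 j _ hj hjm' halg)
  · -- the cell steps
    intro j hj hj1m
    have hjm : j + 2 ≤ m := hj1m
    have hjm' : j < m := Nat.lt_of_succ_lt hj1m
    have h1j1 : 1 ≤ j + 1 := Nat.le_add_left 1 j
    have h1j2 : 1 ≤ j + 2 := Nat.le_add_left 1 (j + 1)
    have ha : IsAlgebraic ℚ (Qf (x (j + 1))) := hQfalg (j + 1) h1j1 hj1m
    have hb : IsAlgebraic ℚ (Qf (x j)) := hQfalg j hj hjm'
    obtain ⟨hmono, himg, -, -⟩ := hτcell j hj hjm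
    obtain ⟨-, hstep, hQfc', hQfd', -⟩ := hrows j hj hjm
    obtain ⟨hLd, hLi⟩ := hL1 _ (ha.sub hb)
    have A : of (C1 (j + 1)) - of (C1 j) - of (L1 (Qf (x (j + 1)) - Qf (x j))) ∈ relations :=
      stub_cellStepInst g₂ g₃ e₁ (x 2) (x 1) (x (j + 1)) (x j) (x (j + 2)) (x (j + 1)) Cb f τ τ' Qf (C1 j)
        (C1 (j + 1)) (L1 (Qf (x (j + 1)) - Qf (x j))) hf ag₂ ag₃ hx2alg hx1alg (hgAlg' (j + 1) h1j1 hj1m.le)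
        (hgAlg' j hj hjm'.le) (hgAlg' (j + 2) h1j2 hjm) (hgAlg' (j + 1) h1j1 hj1m.le) he₁pos hx2low.1 hx21
        (hgLow (j + 1) h1j1 hj1m).1 (hgDec j hj hjm') (hxm.symm.le.trans (hanti (j + 2) m h1j2 hjm hmm))
        (hgDec (j + 1) h1j1 hj1m) hfpos hCbd (hInt.mono_set fun t ht => hx2low.1.trans ht.1)
        (hInt.mono_set (hrow_sub j hj hjm')) hmono himg hstep (hsemi _ (hrowσ j hj hjm')).1
        (hsemi _ (hIccσ j hj hjm')).2.1 hQfc' hQfd' (hC1 j hj hjm').1 (hC1 j hj hjm').2 (hC1 (j + 1) h1j1 hj1m).1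
        (hC1 (j + 1) h1j1 hj1m).2 hLd hLi
    -- `ℓ(a − b) ≡ ℓ(a) − ℓ(b)`
    obtain ⟨hda, hia⟩ := hL1 _ ha
    obtain ⟨hdb, hib⟩ := hL1 _ hb
    have D : of (L1 (Qf (x (j + 1)))) - of (L1 (Qf (x (j + 1)) - Qf (x j))) - of (L1 (Qf (x j))) ∈ relations := by
      refine hsplit1 _ _ _ (by rw [hLd, hda]) (by rw [hdb, hda]) fun t ht => ?_
      rw [Pi.add_apply, hia ht, hLi (by rw [hLd, ← hda]; exact ht), hib (by rw [hdb, ← hda]; exact ht)]; ring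
    rw [show of (C1 (j + 1)) - of (C1 j) - of (L1 (Qf (x (j + 1)))) + of (L1 (Qf (x j))) =
      (of (C1 (j + 1)) - of (C1 j) - of (L1 (Qf (x (j + 1)) - Qf (x j))))
      - (of (L1 (Qf (x (j + 1)))) - of (L1 (Qf (x (j + 1)) - Qf (x j))) - of (L1 (Qf (x j)))) by abel]
    exact relations.sub_mem A D
  · -- additivity of the constants
    intro a b ha hb
    obtain ⟨hd, hi⟩ := hL1 _ (ha.add hb)
    obtain ⟨hda, hia⟩ := hL1 _ ha
    obtain ⟨hdb, hib⟩ := hL1 _ hb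
    refine hsplit1 _ _ _ (by rw [hda, hd]) (by rw [hdb, hd]) fun t ht => ?_
    rw [Pi.add_apply, hi ht, hia (by rw [hda, ← hd]; exact ht), hib (by rw [hdb, ← hd]; exact ht)]; ring

end Summit.KontsevichZagierPeriods.KontsevichZagierPeriods.Cruxes.NeronTorsionSector.Translation
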